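import Mathlib
import HarnessLib

/-!
# The sector-weight test V3 on a once-visited reference sector: the two error models of the
# frozen scorer pair in closed form

HONEST FRAMING: exact (Metropolis-corrected) sampling algorithms for lattice gauge theory;
figures of merit are autocorrelation/cost numbers at stated couplings and volumes; no
continuum-physics claim.

Venture `LatticeQCDFlow` (cell pub-lqcd), sub-topic `Scoring`; FANOUT row 11 (`eng-scorerA`,
fitness scorer A).  NEW WORK of the cell (elementary real arithmetic), not a published result;
nothing is cited as a fact.  Companion of `TunnellingBudget` (row 11's A-side read of the first
A/B verdict split on an honest engine row, HOME/eng-scorera/RESCORE-A-fthmc-v02.md ADDENDUM 2, and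
the LEADERBOARD-2 docket item L2-A14 it raised).

## Content

FITNESS §4 / RF-4: for every reference sector `k` (exact weight `π_k ≥ 1 %`) the row FAILS V3 when
`|p̂_k − π_k| > 3.5 σ`, with EACH SCORER'S OWN `σ`.  Consider a reference sector visited exactly
ONCE in `N` samples, `p̂ = 1/N` (row 14's 2-d U(1) 16² β 7 HMC row at `N = 10⁵`, `π = 0.0545`):

* scorer A's `σ` is the Γ-method error of the indicator series `1[Q = k]` itself; a lone spike is
  white to the Γ method (`τ̂ = 1/2`), so `σ_A = √(p̂(1 − p̂)/N)` and (`zA_eq`)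

    `z_A = (π − 1/N)/σ_A = (πN − 1)/√(1 − 1/N) ≥ πN − 1`

  — **linear in `N` and blind to the chain's autocorrelation**: A rejects a once-visited sector as
  soon as `πN > 4.5` (`zA_gt_of`), i.e. as soon as equilibrium would have put more than 4.5 samples
  there; a LONGER frozen run fails HARDER;
* scorer B's `σ` is the binomial model error inflated by the label series' own integrated time,
  `σ_B = √(π(1 − π)·2τ/N)`, so (`zB_le_sqrt`)

    `z_B = (π − 1/N)/σ_B ≤ √(πN/(2τ(1 − π))) = √(π·n_eff/(1 − π))`,  `n_eff = N/(2τ)`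

  — **B can never reject an (almost) empty reference sector whose expected number of effectively
  independent visits `π·n_eff` is below `12.25·(1 − π)`** (`zB_le_threshold`), however empty it is;
  in the frozen regime (`τ` of the order of `N`) that is every sector.

Neither `σ` is 'the' error of a once-visited sector (A's under-covers — the indicator's true `τ` is
of the order of the dwell time, invisible from one visit; B's answers a different question — 'is
one visit consistent with `π` given `n_eff` samples'), which is why the docket item asks the
arbiter to pick ONE model for both scorers.  Record numbers (`zA_record`, `zB_record_lt_one`):
`π = 0.0545 = 109/2000`, `N = 10⁵`, `τ_label = 3 842` ⇒ `z_A ≥ 5 449 > 3.5` (A printed 5 448.9)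
while `z_B² ≤ 5 450/(7 684 · 0.9455) < 1` (B printed 0.87).
-/

namespace Summit.Ventures.LatticeQCDFlow.Scoring

open Real

/-! ### Scorer A: Γ-error of the lone-visit indicator -/

/-- Scorer A's error for the weight of a sector visited once in `N` samples: the white-noise
(`τ = 1/2`) error of a 0/1 series with mean `p̂ = 1/N`, `σ_A = √(p̂ (1 − p̂) / N)`. -/
noncomputable def sigmaA (N : ℝ) : ℝ :=
  sqrt ((1 / N) * (1 - 1 / N) / N)

/-- Scorer A's V3 statistic on that sector: `z_A = (π − p̂)/σ_A`. -/
noncomputable def zA (w N : ℝ) : ℝ :=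
  (w - 1 / N) / sigmaA N

/-- `σ_A = √(1 − 1/N) / N` for `N > 0`. -/
theorem sigmaA_eq {N : ℝ} (hN : 0 < N) : sigmaA N = sqrt (1 - 1 / N) / N := by
  unfold sigmaA
  have h : (1 / N) * (1 - 1 / N) / N = (1 - 1 / N) / N ^ 2 := by
    field_simp
  rw [h, sqrt_div' _ (sq_nonneg N), sqrt_sq hN.le]

/-- **Closed form**: `z_A = (πN − 1)/√(1 − 1/N)` (`N > 1`). -/
theorem zA_eq {w N : ℝ} (hN : 1 < N) : zA w N = (w * N - 1) / sqrt (1 - 1 / N) := by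
  have hN0 : 0 < N := by linarith
  have hs : 0 < sqrt (1 - 1 / N) := by
    apply sqrt_pos.2
    have : 1 / N < 1 := by rw [div_lt_one hN0]; exact hN
    linarith
  unfold zA
  rw [sigmaA_eq hN0]
  field_simp

/-- **`z_A ≥ πN − 1`**: A's statistic for a once-visited sector grows (at least) linearly in `N`,
whatever the chain's autocorrelation (`N > 1`, `πN ≥ 1`). -/
theorem sub_one_le_zA {w N : ℝ} (hN : 1 < N) (hw : 1 ≤ w * N) : w * N - 1 ≤ zA w N := by
  have hN0 : 0 < N := by linarith
  have hlt : 1 / N < 1 := by rw [div_lt_one hN0]; exact hN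
  have hs : 0 < sqrt (1 - 1 / N) := sqrt_pos.2 (by linarith)
  have hs1 : sqrt (1 - 1 / N) ≤ 1 := by
    rw [show (1 : ℝ) = sqrt 1 from sqrt_one.symm]
    exact sqrt_le_sqrt (by have := div_nonneg zero_le_one hN0.le; linarith)
  rw [zA_eq hN, le_div_iff₀ hs]
  have hnn : 0 ≤ w * N - 1 := by linarith
  calc (w * N - 1) * sqrt (1 - 1 / N) ≤ (w * N - 1) * 1 := by gcongr
    _ = w * N - 1 := mul_one _

/-- **A rejects a once-visited reference sector as soon as `πN > 4.5`** (threshold `3.5 σ`,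
RF-4). -/
theorem zA_gt_of {w N : ℝ} (hN : 1 < N) (hw : 4.5 < w * N) : 3.5 < zA w N := by
  have h := sub_one_le_zA hN (by linarith)
  linarith

/-! ### Scorer B: binomial model error inflated by the label series' `τ` -/

/-- Scorer B's error for the same sector: `σ_B = √(π (1 − π) · 2τ / N)` with `τ` the integrated
time of the rounded-charge label series (scorer_b.py V3, chain mode). -/
noncomputable def sigmaB (w N τ : ℝ) : ℝ :=
  sqrt (w * (1 - w) * (2 * τ) / N)

/-- Scorer B's V3 statistic on the once-visited sector: `z_B = (π − 1/N)/σ_B`. -/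
noncomputable def zB (w N τ : ℝ) : ℝ :=
  (w - 1 / N) / sigmaB w N τ

/-- `σ_B > 0` for `0 < π < 1`, `τ > 0`, `N > 0`. -/
theorem sigmaB_pos {w N τ : ℝ} (hw0 : 0 < w) (hw1 : w < 1) (hτ : 0 < τ) (hN : 0 < N) :
    0 < sigmaB w N τ := by
  unfold sigmaB
  apply sqrt_pos.2
  have : 0 < 1 - w := by linarith
  positivity

/-- **`z_B ≤ √(πN/(2τ(1 − π)))`** `= √(π · n_eff/(1 − π))` with `n_eff = N/(2τ)`: B's statistic
on a once-visited sector is bounded by the square root of the expected number of EFFECTIVELY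
independent visits (up to the factor `1/(1 − π)`). -/
theorem zB_le_sqrt {w N τ : ℝ} (hw0 : 0 < w) (hw1 : w < 1) (hτ : 0 < τ) (hN : 0 < N) :
    zB w N τ ≤ sqrt (w * N / (2 * τ * (1 - w))) := by
  have hσ := sigmaB_pos hw0 hw1 hτ hN
  have h1w : 0 < 1 - w := by linarith
  -- numerator bound: w − 1/N ≤ w
  have hnum : w - 1 / N ≤ w := by
    have := div_nonneg zero_le_one hN.le; linarith
  have step1 : zB w N τ ≤ w / sigmaB w N τ := by
    unfold zB; exact div_le_div_of_nonneg_right hnum hσ.le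
  -- and w / σ_B = √(w N/(2τ(1−w)))
  have hX : 0 < w * (1 - w) * (2 * τ) / N := by positivity
  have step2 : w / sigmaB w N τ = sqrt (w * N / (2 * τ * (1 - w))) := by
    have hw1' : (1 - w) ≠ 0 := h1w.ne'
    calc w / sigmaB w N τ = sqrt (w ^ 2) / sqrt (w * (1 - w) * (2 * τ) / N) := by
          rw [sigmaB, sqrt_sq hw0.le]
      _ = sqrt (w ^ 2 / (w * (1 - w) * (2 * τ) / N)) := (sqrt_div' _ hX.le).symm
      _ = sqrt (w * N / (2 * τ * (1 - w))) := by
          congr 1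
          field_simp
  rw [← step2]; exact step1

/-- **B cannot reject an almost-empty reference sector unless `πN/(2τ(1 − π)) > 12.25`**, i.e.
unless the expected number of effectively independent visits `π·n_eff` exceeds `12.25 (1 − π)`
(threshold `3.5 σ`). -/
theorem zB_le_threshold {w N τ : ℝ} (hw0 : 0 < w) (hw1 : w < 1) (hτ : 0 < τ) (hN : 0 < N)
    (h : w * N / (2 * τ * (1 - w)) ≤ 12.25) : zB w N τ ≤ 3.5 := by
  have hb := zB_le_sqrt hw0 hw1 hτ hN
  have hs : sqrt (w * N / (2 * τ * (1 - w))) ≤ 3.5 := by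
    rw [show (3.5 : ℝ) = sqrt (3.5 ^ 2) by rw [sqrt_sq]; norm_num]
    exact sqrt_le_sqrt (by norm_num; linarith)
  exact hb.trans hs

/-! ### The record (row 14's β 7 HMC row, kit j131129; RESCORE-A-fthmc-v02.md ADDENDUM 2) -/

/-- `π = 0.0545 (= 109/2000)`, `N = 10⁵`: `z_A ≥ πN − 1 = 5 449 > 3.5` — A raises
`V3:sector-weight:-2` (printed z 5 448.9). -/
theorem zA_record : (3.5 : ℝ) < zA (109 / 2000) 100000 := by
  apply zA_gt_of (by norm_num)
  norm_num

/-- Same sector under B's model with `τ_label = 3 842`: `z_B ≤ √(5 450/(7 684 · 0.9455)) < 1 ≤ 3.5`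
— B passes it (printed z 0.87). -/
theorem zB_record_lt_one : zB (109 / 2000) 100000 3842 < 1 := by
  have hb := zB_le_sqrt (w := 109 / 2000) (N := 100000) (τ := 3842)
    (by norm_num) (by norm_num) (by norm_num) (by norm_num)
  have hlt : sqrt ((109 / 2000 : ℝ) * 100000 / (2 * 3842 * (1 - 109 / 2000))) < 1 := by
    rw [show (1 : ℝ) = sqrt 1 from sqrt_one.symm]
    apply sqrt_lt_sqrt (by positivity)
    norm_num
  exact hb.trans_lt hlt

/-- Hence B's verdict on that sector is 'ok' at the 3.5 σ threshold. -/
theorem zB_record_le_threshold : zB (109 / 2000) 100000 3842 ≤ 3.5 := by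
  have := zB_record_lt_one; linarith

/-- **The split in one line**: on the same once-visited sector of the same file, A's statistic is
above the common threshold and B's is below it. -/
theorem verdict_split_record :
    (3.5 : ℝ) < zA (109 / 2000) 100000 ∧ zB (109 / 2000) 100000 3842 ≤ 3.5 :=
  ⟨zA_record, zB_record_le_threshold⟩

/-! ### The arbiter's LEADERBOARD-2 rule (b): the floored error (row 37, ARBITRATION-L2-A14.md, 2026-08-21T11:52Z)

RULED for the next freeze, in BOTH scorers: `σ_V3(k) := max(σ_Γ(1[Q = k]), σ_floor)` with
`σ_floor = √(π_k(1 − π_k)·2τ_F1/N)` (`τ_F1` = the τ behind the row's own `F₁`), threshold 3.5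
unchanged, plus a WARN `V3:sector-starved` when `π_k · n_eff < 5`.  Nothing frozen moves; the typed
facts below are what the rule guarantees (row 11's candidate: HOME/eng-scorera/docket-L2-A14/).

* `zRuled_le_floor_only` / `zRuled_le_gamma_only` — the `max` in the denominator makes the ruled
  statistic no larger than EITHER single-model statistic: it can only remove HARD tokens relative to
  frozen A (Γ only) and relative to a floor-only scorer, never add one;
* `zRuled_lone_le_threshold` — on a once-visited sector the ruled statistic inherits B's bound, so it
  is `≤ 3.5` whenever `πN/(2τ(1 − π)) ≤ 12.25`: **no lone-visit HARD in either scorer** below ≈ 12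
  expected effective visits (that regime is flagged by the WARN instead);
* `zRuled_record_le_threshold` — the split row under the rule with A's own numbers
  (`σ_Γ = 10⁻⁵`, `τ_F1 = τ̂(Q²) = 1 557`): `z ≤ √(5 450/(3 114 · 0.9455)) < 1.37 ≤ 3.5` (candidate
  printed 1.36) — A and B agree: VALID + starved. -/

/-- The ruled V3 error: the larger of the Γ error of the indicator and the binomial-at-`n_eff` floor
(`sigmaB` with `τ = τ_F1`). -/
noncomputable def sigmaRuled (σΓ w N τ : ℝ) : ℝ :=
  max σΓ (sigmaB w N τ)

/-- The ruled V3 statistic for a measured weight `p` against the exact weight `w`. -/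
noncomputable def zRuled (σΓ p w N τ : ℝ) : ℝ :=
  |p - w| / sigmaRuled σΓ w N τ

/-- The ruled statistic is at most the floor-only statistic. -/
theorem zRuled_le_floor_only {σΓ p w N τ : ℝ} (hw0 : 0 < w) (hw1 : w < 1) (hτ : 0 < τ)
    (hN : 0 < N) : zRuled σΓ p w N τ ≤ |p - w| / sigmaB w N τ := by
  unfold zRuled sigmaRuled
  exact div_le_div_of_nonneg_left (abs_nonneg _) (sigmaB_pos hw0 hw1 hτ hN) (le_max_right _ _)

/-- The ruled statistic is at most the Γ-only statistic (frozen A's): the rule never ADDS a HARD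
`V3:sector-weight` token relative to A 0.1.2. -/
theorem zRuled_le_gamma_only {σΓ p w N τ : ℝ} (hσ : 0 < σΓ) :
    zRuled σΓ p w N τ ≤ |p - w| / σΓ := by
  unfold zRuled sigmaRuled
  exact div_le_div_of_nonneg_left (abs_nonneg _) hσ (le_max_left _ _)

/-- **No lone-visit HARD under the rule**: for a once-visited sector (`p = 1/N ≤ w`) the ruled
statistic is `≤ 3.5` whenever `wN/(2τ(1 − w)) ≤ 12.25`, whatever the Γ error. -/
theorem zRuled_lone_le_threshold {σΓ w N τ : ℝ} (hw0 : 0 < w) (hw1 : w < 1) (hτ : 0 < τ)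
    (hN : 0 < N) (hlone : 1 / N ≤ w) (h : w * N / (2 * τ * (1 - w)) ≤ 12.25) :
    zRuled σΓ (1 / N) w N τ ≤ 3.5 := by
  have h1 := zRuled_le_floor_only (σΓ := σΓ) (p := 1 / N) hw0 hw1 hτ hN
  have h2 : |1 / N - w| / sigmaB w N τ = zB w N τ := by
    unfold zB
    rw [abs_sub_comm, abs_of_nonneg (by linarith)]
  rw [h2] at h1
  exact h1.trans (zB_le_threshold hw0 hw1 hτ hN h)

/-- **The split row under the rule, with A's own inputs** (`σ_Γ = 10⁻⁵`, `w = 109/2000`, `N = 10⁵`,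
`τ_F1 = τ̂(Q²) = 1 557`): `z ≤ 3.5` (the candidate prints 1.36) — A would agree with B. -/
theorem zRuled_record_le_threshold :
    zRuled (1 / 100000) (1 / 100000) (109 / 2000) 100000 1557 ≤ 3.5 := by
  have h := zRuled_lone_le_threshold (σΓ := 1 / 100000) (w := 109 / 2000) (N := 100000) (τ := 1557)
    (by norm_num) (by norm_num) (by norm_num) (by norm_num) (by norm_num) (by norm_num)
  simpa using h

end Summit.Ventures.LatticeQCDFlow.Scoring
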